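import Mathlib
import HarnessLib.Audit
import Summits.PneNP.PneNP.Theorems.PstarMemberKillJoins
import Summits.PneNP.PneNP.Theorems.PstarUnionCovers

/-!
# The member kills for minimal cores (`TerminalNC`): (T3) + (M0) at one member suffice (ROUND-24, O1; memo g28 §76b)

FRONTIER range-avoidance ladder, rung F-N3, ROUND 24 (cell `pnp-ideate`, prover-2 memo `g28/O1-JOINS-g28.md` §76b; census node
`PstarLocalGateBudgetAssembly.LocalMenuCriterionBoundGateBudget`; restricted-model proof complexity — nothing here bears on `P` versus `NP`).

The census obligation `PstarLocalCriterion.NoLocalCore` quantifies over `PstarUnionCovers.TerminalNC` cores `M ⊆ K₀` — (T3) + (M0) WITHOUT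
XOR-closedness (a sub-path of a cycle core is allowed) — whereas the member kills of `PstarDirtyMemberSquare`, `PstarSharedMemberKill` and
`PstarMemberKillJoins` were stated against `PstarCoreBoundTargets.Terminal`.  Their proofs use only (T3) and (M0) AT THE KILLED MEMBER `e`; this file
records them in that minimal form and derives the `TerminalNC` versions:

* `T3_of_not_satPair`, `exists_sliceBut_of_satPair_erase` — `¬ SatPair K` is (T3) on the slice, `SatPair (K ∖ e)` is an (M0)-witness in `Ā`;
* `exists_idle_dirty_of_joins`, `partners_dirty_of_joins`, `exists_idle_shared_of_joins`, `partners_shared_of_joins` — the JOIN-FORM side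
  conditions of `PstarMemberKillJoins` converted to the semantic ones (idle point; frozen-or-thawed partners), once and for all;
* **`false_of_dirty_member_joins`**, **`false_of_shared_member_joins`** — `¬ SatPair K ∧ SatPair (K ∖ e)` is contradictory under the join-form
  hypotheses of the dirty / shared-literal member kill: the common core of the `Terminal` and `TerminalNC` statements;
* **`not_terminalNC_of_dirty_member_joins`**, **`not_terminalNC_of_shared_member_joins`** (and the semantic `not_terminalNC_of_dirty_member`,
  `not_terminalNC_of_shared_member`) — the kills for minimal cores, as the census needs them for sub-families `M ⊆ K₀`.
-/

set_option linter.dupNamespace false -- `Summit.PneNP.PneNP.…`: summit = sub-problem name (D-0017 single-conjunct layout)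

open Finset Literature.Computability.Complexity
open Summit.PneNP.PneNP.Theorems.PstarFibrePolys (bit)
open Summit.PneNP.PneNP.Theorems.PstarTyped (Typed)
open Summit.PneNP.PneNP.Theorems.PstarSALevel (varSet)
open Summit.PneNP.PneNP.Theorems.PstarGapOneAll (gval)
open Summit.PneNP.PneNP.Theorems.PstarUnion (SatPair)
open Summit.PneNP.PneNP.Theorems.PstarUnionCovers (TerminalNC)
open Summit.PneNP.PneNP.Theorems.PstarLiteralPinning (Through InSlice IsJoin joinValue)
open Summit.PneNP.PneNP.Theorems.PstarDeadPatterns (Dead)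
open Summit.PneNP.PneNP.Theorems.PstarDirtyMemberSquare (InSliceBut inSlice_iff gval_ne_on_sliceBut)
open Summit.PneNP.PneNP.Theorems.PstarSharedMemberSquare (Setup)
open Summit.PneNP.PneNP.Theorems.PstarSharedMemberKill (gval_ne_on_sliceBut_shared)
open Summit.PneNP.PneNP.Theorems.PstarMemberKillJoins (frozen_of_block_join thawed_of_no_dead_join exists_false_of_no_dead_join_singleton)

namespace Summit.PneNP.PneNP.Theorems.PstarMemberKillCores

variable {n m : ℕ} {I : LocalMap 4 n m} {y : Fin m → Bool} {K : Finset (Fin m)} {w₁ w₂ : Finset (Fin n) × Finset (Fin m) × Bool}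

/-! ## (T3) and (M0) in slice vocabulary -/

/-- **(T3) on the slice**: if the pair is unsatisfiable over `K`, the second reader misses `b₂` at every point of the slice of `(K; Γ₁)`. -/
theorem T3_of_not_satPair (h : ¬ SatPair I y K w₁ w₂) : ∀ z, InSlice I y K w₁ z → gval I w₂.1 w₂.2.1 z ≠ w₂.2.2 :=
  fun z hz h₂ => h ⟨z, hz.1, hz.2, h₂⟩

/-- **An (M0)-witness at `e` is a point of the big slice `Ā` where the second reader is on target.** -/
theorem exists_sliceBut_of_satPair_erase {e : Fin m} (h : SatPair I y (K.erase e) w₁ w₂) :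
    ∃ q, InSliceBut I y K e w₁ q ∧ gval I w₂.1 w₂.2.1 q = w₂.2.2 := by
  obtain ⟨q, hqK, hq₁, hq₂⟩ := h
  exact ⟨q, ⟨fun j hj hje => hqK j (mem_erase.2 ⟨hje, hj⟩), hq₁⟩, hq₂⟩

/-- `TerminalNC` gives (T3). -/
theorem terminalNC_T3 {r : ℕ} (ht : TerminalNC I r y K w₁ w₂) : ∀ z, InSlice I y K w₁ z → gval I w₂.1 w₂.2.1 z ≠ w₂.2.2 :=
  T3_of_not_satPair ht.2.2.2.2.2.1

/-- `TerminalNC` gives an (M0)-witness at every member. -/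
theorem terminalNC_M0 {r : ℕ} (ht : TerminalNC I r y K w₁ w₂) {e : Fin m} (he : e ∈ K) :
    ∃ q, InSliceBut I y K e w₁ q ∧ gval I w₂.1 w₂.2.1 q = w₂.2.2 :=
  exists_sliceBut_of_satPair_erase (ht.2.2.2.2.2.2 e he)

/-- Every slot variable of an output lies in its variable set. -/
private theorem vars_mem_varSet (I : LocalMap 4 n m) (j : Fin m) (s : Fin 4) : I.vars j s ∈ varSet I j := by
  unfold PstarSALevel.varSet; exact mem_image_of_mem _ (mem_univ s)

/-! ## The join-form side conditions, converted -/

section Dirty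

variable {e : Fin m} {p p' : Fin n}

/-- **Idle point of a dirty member from the join condition on the pattern `{p}`.** -/
theorem exists_idle_dirty_of_joins (hI : I.IsPure xorAndPred) (hT : Typed I) (hKG : Disjoint K w₁.2.1)
    (hpe : I.vars e 0 ≠ p ∧ I.vars e 1 ≠ p ∧ I.vars e 0 ≠ p' ∧ I.vars e 1 ≠ p')
    (hpK : ∀ j ∈ K, j ≠ e → p ∉ varSet I j ∧ p' ∉ varSet I j) (hpC₁ : p ∉ w₁.1 ∧ p' ∉ w₁.1)
    (hC₁ : ∀ v ∈ w₁.1, ∀ j ∈ K ∪ w₁.2.1, ¬ Through I v j)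
    (hpriv : ∀ j ∈ K ∪ w₁.2.1, ∃ a, Through I a j ∧ ∀ j' ∈ K ∪ w₁.2.1, Through I a j' → j' = j)
    (hidle : ∀ D ⊆ K, ∀ t : Bool, IsJoin I w₁.1 D t → (∀ j ∈ D, Through I p j) → (t = true → ∀ g ∈ w₁.2.1, Through I p g) →
      joinValue y w₁.2.2 D t ≠ 1) :
    ∃ z, InSlice I y K w₁ z ∧ (z p && z p') = false := by
  haveI : Nonempty (Fin n) := ⟨p⟩
  have hpX : ∀ j ∈ K, I.vars j 0 ≠ p ∧ I.vars j 1 ≠ p := by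
    intro j hj
    by_cases hje : j = e
    · subst hje; exact ⟨hpe.1, hpe.2.1⟩
    · have h := (hpK j hj hje).1
      exact ⟨fun h0 => h (h0 ▸ vars_mem_varSet I j 0), fun h1 => h (h1 ▸ vars_mem_varSet I j 1)⟩
  obtain ⟨z₀, hz₀, hz₀p⟩ := exists_false_of_no_dead_join_singleton hI hT hKG hC₁ hpX hpC₁.1 (fun j hj _ => hpriv j hj) hidle
  exact ⟨z₀, hz₀, by rw [hz₀p, Bool.false_and]⟩

/-- **Frozen-or-thawed partners of a dirty member from the join conditions.** -/
theorem partners_dirty_of_joins (hI : I.IsPure xorAndPred) (hT : Typed I) (hKG : Disjoint K w₁.2.1)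
    (hC₁ : ∀ v ∈ w₁.1, ∀ j ∈ K ∪ w₁.2.1, ¬ Through I v j)
    (hpriv : ∀ j ∈ K ∪ w₁.2.1, ∃ a, Through I a j ∧ ∀ j' ∈ K ∪ w₁.2.1, Through I a j' → j' = j)
    (hpart : ∀ g ∈ w₂.2.1, ∀ u v : Fin n, (v = p ∨ v = p') → ((I.vars g 2 = v ∧ I.vars g 3 = u) ∨ (I.vars g 2 = u ∧ I.vars g 3 = v)) →
      (∃ D ⊆ K.erase e, ∃ t : Bool, IsJoin I w₁.1 D t ∧ (∀ j ∈ D, Through I u j) ∧ (t = true → ∀ g' ∈ w₁.2.1, Through I u g') ∧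
          joinValue y w₁.2.2 D t = 1) ∨
      (u ∉ w₁.1 ∧ (∀ j ∈ K, I.vars j 0 ≠ u ∧ I.vars j 1 ≠ u) ∧
        ∃ Z : Finset (Fin n), v ∈ Z ∧ (∀ j ∈ K ∪ w₁.2.1, (I.vars j 2 = u → I.vars j 3 ∈ Z) ∧ (I.vars j 3 = u → I.vars j 2 ∈ Z)) ∧
          (∀ w ∈ Z, ∀ j ∈ K, I.vars j 0 ≠ w ∧ I.vars j 1 ≠ w) ∧ (∀ w ∈ Z, w ∉ w₁.1) ∧
          ∀ D ⊆ K, ∀ t : Bool, IsJoin I w₁.1 D t → (∀ j ∈ D, Dead I Z j) → (t = true → ∀ g' ∈ w₁.2.1, Dead I Z g') →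
            joinValue y w₁.2.2 D t ≠ 1)) :
    ∀ g ∈ w₂.2.1, ∀ u v : Fin n, (v = p ∨ v = p') → ((I.vars g 2 = v ∧ I.vars g 3 = u) ∨ (I.vars g 2 = u ∧ I.vars g 3 = v)) →
      (∀ q q' : Fin n → Bool, InSliceBut I y K e w₁ q → InSliceBut I y K e w₁ q' → q u = q' u) ∨
      (∃ z, (InSlice I y K w₁ z ∧ (z p && z p') = false) ∧ InSlice I y K w₁ (Function.update z u (!z u))) := by
  intro g hg u v hv hgs
  rcases hpart g hg u v hv hgs with ⟨D, hD, t, hJ, hDu, hGu, hval⟩ | ⟨huC, huX, Z, hvZ, huZ, hZX, hZC, hnoZ⟩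
  · exact Or.inl (frozen_of_block_join hI hD hJ hDu hGu hval)
  · haveI : Nonempty (Fin n) := ⟨u⟩
    obtain ⟨z, ⟨hz, hzv⟩, hz'⟩ := thawed_of_no_dead_join hI hT hKG hC₁ hZX hZC (fun j hj _ => hpriv j hj) hnoZ hvZ huZ huC huX
    refine Or.inr ⟨z, ⟨hz, ?_⟩, hz'⟩
    rcases hv with rfl | rfl
    · rw [hzv, Bool.false_and]
    · rw [hzv, Bool.and_false]

/-- **(T3) + (M0) AT A DIRTY MEMBER IS CONTRADICTORY — JOIN FORM.**  The common core of `PstarMemberKillJoins.not_terminal_of_dirty_member_joins` and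
its `TerminalNC` version: hypotheses as there, with `Terminal` replaced by `¬ SatPair K` ((T3)) and `SatPair (K ∖ e)` ((M0) at `e`). -/
theorem false_of_dirty_member_joins (hI : I.IsPure xorAndPred) (hT : Typed I) (he : e ∈ K) (hKG : Disjoint K w₁.2.1)
    (hslots : I.vars e 2 = p ∧ I.vars e 3 = p') (hpe : I.vars e 0 ≠ p ∧ I.vars e 1 ≠ p ∧ I.vars e 0 ≠ p' ∧ I.vars e 1 ≠ p')
    (hpK : ∀ j ∈ K, j ≠ e → p ∉ varSet I j ∧ p' ∉ varSet I j) (hpC₁ : p ∉ w₁.1 ∧ p' ∉ w₁.1)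
    (hpG₁ : ∀ g ∈ w₁.2.1, (I.vars g 2 ≠ p ∧ I.vars g 3 ≠ p) ∧ (I.vars g 2 ≠ p' ∧ I.vars g 3 ≠ p'))
    (hpp' : ∀ g ∈ w₂.2.1, ¬ ((I.vars g 2 = p ∧ I.vars g 3 = p') ∨ (I.vars g 2 = p' ∧ I.vars g 3 = p)))
    (hSG : ∀ g ∈ w₂.2.1, ∀ g' ∈ w₂.2.1, g' ≠ g → ¬ ((I.vars g' 2 = I.vars g 2 ∧ I.vars g' 3 = I.vars g 3) ∨
      (I.vars g' 2 = I.vars g 3 ∧ I.vars g' 3 = I.vars g 2)))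
    (hC₁ : ∀ v ∈ w₁.1, ∀ j ∈ K ∪ w₁.2.1, ¬ Through I v j)
    (hpriv : ∀ j ∈ K ∪ w₁.2.1, ∃ a, Through I a j ∧ ∀ j' ∈ K ∪ w₁.2.1, Through I a j' → j' = j)
    (hidle : ∀ D ⊆ K, ∀ t : Bool, IsJoin I w₁.1 D t → (∀ j ∈ D, Through I p j) → (t = true → ∀ g ∈ w₁.2.1, Through I p g) →
      joinValue y w₁.2.2 D t ≠ 1)
    (hpart : ∀ g ∈ w₂.2.1, ∀ u v : Fin n, (v = p ∨ v = p') → ((I.vars g 2 = v ∧ I.vars g 3 = u) ∨ (I.vars g 2 = u ∧ I.vars g 3 = v)) →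
      (∃ D ⊆ K.erase e, ∃ t : Bool, IsJoin I w₁.1 D t ∧ (∀ j ∈ D, Through I u j) ∧ (t = true → ∀ g' ∈ w₁.2.1, Through I u g') ∧
          joinValue y w₁.2.2 D t = 1) ∨
      (u ∉ w₁.1 ∧ (∀ j ∈ K, I.vars j 0 ≠ u ∧ I.vars j 1 ≠ u) ∧
        ∃ Z : Finset (Fin n), v ∈ Z ∧ (∀ j ∈ K ∪ w₁.2.1, (I.vars j 2 = u → I.vars j 3 ∈ Z) ∧ (I.vars j 3 = u → I.vars j 2 ∈ Z)) ∧
          (∀ w ∈ Z, ∀ j ∈ K, I.vars j 0 ≠ w ∧ I.vars j 1 ≠ w) ∧ (∀ w ∈ Z, w ∉ w₁.1) ∧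
          ∀ D ⊆ K, ∀ t : Bool, IsJoin I w₁.1 D t → (∀ j ∈ D, Dead I Z j) → (t = true → ∀ g' ∈ w₁.2.1, Dead I Z g') →
            joinValue y w₁.2.2 D t ≠ 1))
    (hT3 : ¬ SatPair I y K w₁ w₂) (hM0 : SatPair I y (K.erase e) w₁ w₂) : False := by
  obtain ⟨q, hq, hq₂⟩ := exists_sliceBut_of_satPair_erase hM0
  exact gval_ne_on_sliceBut hI he hslots hpe hpK hpC₁ hpG₁ hpp' (T3_of_not_satPair hT3) hSG
    (exists_idle_dirty_of_joins hI hT hKG hpe hpK hpC₁ hC₁ hpriv hidle) (partners_dirty_of_joins hI hT hKG hC₁ hpriv hpart) hq hq₂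

/-- **THE DIRTY-MEMBER KILL FOR MINIMAL CORES (`TerminalNC`), JOIN FORM.** -/
theorem not_terminalNC_of_dirty_member_joins {r : ℕ} (hI : I.IsPure xorAndPred) (hT : Typed I) (he : e ∈ K) (hKG : Disjoint K w₁.2.1)
    (hslots : I.vars e 2 = p ∧ I.vars e 3 = p') (hpe : I.vars e 0 ≠ p ∧ I.vars e 1 ≠ p ∧ I.vars e 0 ≠ p' ∧ I.vars e 1 ≠ p')
    (hpK : ∀ j ∈ K, j ≠ e → p ∉ varSet I j ∧ p' ∉ varSet I j) (hpC₁ : p ∉ w₁.1 ∧ p' ∉ w₁.1)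
    (hpG₁ : ∀ g ∈ w₁.2.1, (I.vars g 2 ≠ p ∧ I.vars g 3 ≠ p) ∧ (I.vars g 2 ≠ p' ∧ I.vars g 3 ≠ p'))
    (hpp' : ∀ g ∈ w₂.2.1, ¬ ((I.vars g 2 = p ∧ I.vars g 3 = p') ∨ (I.vars g 2 = p' ∧ I.vars g 3 = p)))
    (hSG : ∀ g ∈ w₂.2.1, ∀ g' ∈ w₂.2.1, g' ≠ g → ¬ ((I.vars g' 2 = I.vars g 2 ∧ I.vars g' 3 = I.vars g 3) ∨
      (I.vars g' 2 = I.vars g 3 ∧ I.vars g' 3 = I.vars g 2)))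
    (hC₁ : ∀ v ∈ w₁.1, ∀ j ∈ K ∪ w₁.2.1, ¬ Through I v j)
    (hpriv : ∀ j ∈ K ∪ w₁.2.1, ∃ a, Through I a j ∧ ∀ j' ∈ K ∪ w₁.2.1, Through I a j' → j' = j)
    (hidle : ∀ D ⊆ K, ∀ t : Bool, IsJoin I w₁.1 D t → (∀ j ∈ D, Through I p j) → (t = true → ∀ g ∈ w₁.2.1, Through I p g) →
      joinValue y w₁.2.2 D t ≠ 1)
    (hpart : ∀ g ∈ w₂.2.1, ∀ u v : Fin n, (v = p ∨ v = p') → ((I.vars g 2 = v ∧ I.vars g 3 = u) ∨ (I.vars g 2 = u ∧ I.vars g 3 = v)) →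
      (∃ D ⊆ K.erase e, ∃ t : Bool, IsJoin I w₁.1 D t ∧ (∀ j ∈ D, Through I u j) ∧ (t = true → ∀ g' ∈ w₁.2.1, Through I u g') ∧
          joinValue y w₁.2.2 D t = 1) ∨
      (u ∉ w₁.1 ∧ (∀ j ∈ K, I.vars j 0 ≠ u ∧ I.vars j 1 ≠ u) ∧
        ∃ Z : Finset (Fin n), v ∈ Z ∧ (∀ j ∈ K ∪ w₁.2.1, (I.vars j 2 = u → I.vars j 3 ∈ Z) ∧ (I.vars j 3 = u → I.vars j 2 ∈ Z)) ∧
          (∀ w ∈ Z, ∀ j ∈ K, I.vars j 0 ≠ w ∧ I.vars j 1 ≠ w) ∧ (∀ w ∈ Z, w ∉ w₁.1) ∧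
          ∀ D ⊆ K, ∀ t : Bool, IsJoin I w₁.1 D t → (∀ j ∈ D, Dead I Z j) → (t = true → ∀ g' ∈ w₁.2.1, Dead I Z g') →
            joinValue y w₁.2.2 D t ≠ 1)) :
    ¬ TerminalNC I r y K w₁ w₂ := fun ht =>
  false_of_dirty_member_joins hI hT he hKG hslots hpe hpK hpC₁ hpG₁ hpp' hSG hC₁ hpriv hidle hpart ht.2.2.2.2.2.1 (ht.2.2.2.2.2.2 e he)

/-- **The semantic dirty-member kill for minimal cores** (`PstarDirtyMemberSquare.not_terminal_of_dirty_member` with `TerminalNC`). -/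
theorem not_terminalNC_of_dirty_member {r : ℕ} (hI : I.IsPure xorAndPred) (he : e ∈ K)
    (hslots : I.vars e 2 = p ∧ I.vars e 3 = p') (hpe : I.vars e 0 ≠ p ∧ I.vars e 1 ≠ p ∧ I.vars e 0 ≠ p' ∧ I.vars e 1 ≠ p')
    (hpK : ∀ j ∈ K, j ≠ e → p ∉ varSet I j ∧ p' ∉ varSet I j) (hpC₁ : p ∉ w₁.1 ∧ p' ∉ w₁.1)
    (hpG₁ : ∀ g ∈ w₁.2.1, (I.vars g 2 ≠ p ∧ I.vars g 3 ≠ p) ∧ (I.vars g 2 ≠ p' ∧ I.vars g 3 ≠ p'))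
    (hpp' : ∀ g ∈ w₂.2.1, ¬ ((I.vars g 2 = p ∧ I.vars g 3 = p') ∨ (I.vars g 2 = p' ∧ I.vars g 3 = p)))
    (hSG : ∀ g ∈ w₂.2.1, ∀ g' ∈ w₂.2.1, g' ≠ g → ¬ ((I.vars g' 2 = I.vars g 2 ∧ I.vars g' 3 = I.vars g 3) ∨
      (I.vars g' 2 = I.vars g 3 ∧ I.vars g' 3 = I.vars g 2)))
    (hA₀ : ∃ z, InSlice I y K w₁ z ∧ (z p && z p') = false)
    (hthaw : ∀ g ∈ w₂.2.1, ∀ u v : Fin n, (v = p ∨ v = p') → ((I.vars g 2 = v ∧ I.vars g 3 = u) ∨ (I.vars g 2 = u ∧ I.vars g 3 = v)) →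
      (∀ q q' : Fin n → Bool, InSliceBut I y K e w₁ q → InSliceBut I y K e w₁ q' → q u = q' u) ∨
      (∃ z, (InSlice I y K w₁ z ∧ (z p && z p') = false) ∧ InSlice I y K w₁ (Function.update z u (!z u)))) :
    ¬ TerminalNC I r y K w₁ w₂ := by
  intro ht
  obtain ⟨q, hq, hq₂⟩ := terminalNC_M0 ht he
  exact gval_ne_on_sliceBut hI he hslots hpe hpK hpC₁ hpG₁ hpp' (terminalNC_T3 ht) hSG hA₀ hthaw hq hq₂

end Dirty

section Shared

variable {e o : Fin m} {σ p q : Fin n}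

/-- **Idle point of a shared-literal member from the join condition on the pattern `{σ}`.** -/
theorem exists_idle_shared_of_joins (H : Setup I K w₁ w₂ e o σ p q) (hT : Typed I)
    (hC₁ : ∀ v ∈ w₁.1, ∀ j ∈ K ∪ w₁.2.1, ¬ Through I v j)
    (hpriv : ∀ j ∈ K ∪ w₁.2.1, ∃ a, Through I a j ∧ ∀ j' ∈ K ∪ w₁.2.1, Through I a j' → j' = j)
    (hidle : ∀ D ⊆ K, ∀ t : Bool, IsJoin I w₁.1 D t → (∀ j ∈ D, Through I σ j) → (t = true → ∀ g ∈ w₁.2.1, Through I σ g) →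
      joinValue y w₁.2.2 D t ≠ 1) :
    ∃ z, InSlice I y K w₁ z ∧ z σ = false := by
  haveI : Nonempty (Fin n) := ⟨σ⟩
  exact exists_false_of_no_dead_join_singleton H.pure hT H.hKG hC₁ (fun j hj => ⟨(H.hX j hj).1, (H.hX j hj).2.1⟩) H.hC₁.1
    (fun j hj _ => hpriv j hj) hidle

/-- **Frozen-or-thawed partners of a shared-literal member from the join conditions.** -/
theorem partners_shared_of_joins (H : Setup I K w₁ w₂ e o σ p q) (hT : Typed I)
    (hC₁ : ∀ v ∈ w₁.1, ∀ j ∈ K ∪ w₁.2.1, ¬ Through I v j)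
    (hpriv : ∀ j ∈ K ∪ w₁.2.1, ∃ a, Through I a j ∧ ∀ j' ∈ K ∪ w₁.2.1, Through I a j' → j' = j)
    (hpart : ∀ g ∈ w₂.2.1, ∀ u v : Fin n, (v = p ∨ v = q ∨ v = σ) → ((I.vars g 2 = v ∧ I.vars g 3 = u) ∨ (I.vars g 2 = u ∧ I.vars g 3 = v)) →
      u ≠ p → u ≠ q → u ≠ σ →
      (∃ D ⊆ K.erase e, ∃ t : Bool, IsJoin I w₁.1 D t ∧ (∀ j ∈ D, Through I u j) ∧ (t = true → ∀ g' ∈ w₁.2.1, Through I u g') ∧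
          joinValue y w₁.2.2 D t = 1) ∨
      (u ∉ w₁.1 ∧ (∀ j ∈ K, I.vars j 0 ≠ u ∧ I.vars j 1 ≠ u) ∧
        ∃ Z : Finset (Fin n), σ ∈ Z ∧ (∀ j ∈ K ∪ w₁.2.1, (I.vars j 2 = u → I.vars j 3 ∈ Z) ∧ (I.vars j 3 = u → I.vars j 2 ∈ Z)) ∧
          (∀ w ∈ Z, ∀ j ∈ K, I.vars j 0 ≠ w ∧ I.vars j 1 ≠ w) ∧ (∀ w ∈ Z, w ∉ w₁.1) ∧
          ∀ D ⊆ K, ∀ t : Bool, IsJoin I w₁.1 D t → (∀ j ∈ D, Dead I Z j) → (t = true → ∀ g' ∈ w₁.2.1, Dead I Z g') →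
            joinValue y w₁.2.2 D t ≠ 1)) :
    ∀ g ∈ w₂.2.1, ∀ u v : Fin n, (v = p ∨ v = q ∨ v = σ) → ((I.vars g 2 = v ∧ I.vars g 3 = u) ∨ (I.vars g 2 = u ∧ I.vars g 3 = v)) →
      u ≠ p → u ≠ q → u ≠ σ →
      (∀ x x' : Fin n → Bool, InSliceBut I y K e w₁ x → InSliceBut I y K e w₁ x' → x u = x' u) ∨
      (∃ z, (InSlice I y K w₁ z ∧ z σ = false) ∧ InSlice I y K w₁ (Function.update z u (!z u))) := by
  intro g hg u v hv hgs hup huq huσ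
  rcases hpart g hg u v hv hgs hup huq huσ with ⟨D, hD, t, hJ, hDu, hGu, hval⟩ | ⟨huC, huX, Z, hσZ, huZ, hZX, hZC, hnoZ⟩
  · exact Or.inl (frozen_of_block_join H.pure hD hJ hDu hGu hval)
  · haveI : Nonempty (Fin n) := ⟨u⟩
    exact Or.inr (thawed_of_no_dead_join H.pure hT H.hKG hC₁ hZX hZC (fun j hj _ => hpriv j hj) hnoZ hσZ huZ huC huX)

/-- **(T3) + (M0) AT A SHARED-LITERAL MEMBER IS CONTRADICTORY — JOIN FORM.** -/
theorem false_of_shared_member_joins (H : Setup I K w₁ w₂ e o σ p q) (hT : Typed I)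
    (hSG : ∀ g ∈ w₂.2.1, ∀ g' ∈ w₂.2.1, g' ≠ g → ¬ ((I.vars g' 2 = I.vars g 2 ∧ I.vars g' 3 = I.vars g 3) ∨
      (I.vars g' 2 = I.vars g 3 ∧ I.vars g' 3 = I.vars g 2)))
    (hC₁ : ∀ v ∈ w₁.1, ∀ j ∈ K ∪ w₁.2.1, ¬ Through I v j)
    (hpriv : ∀ j ∈ K ∪ w₁.2.1, ∃ a, Through I a j ∧ ∀ j' ∈ K ∪ w₁.2.1, Through I a j' → j' = j)
    (hidle : ∀ D ⊆ K, ∀ t : Bool, IsJoin I w₁.1 D t → (∀ j ∈ D, Through I σ j) → (t = true → ∀ g ∈ w₁.2.1, Through I σ g) →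
      joinValue y w₁.2.2 D t ≠ 1)
    (hpart : ∀ g ∈ w₂.2.1, ∀ u v : Fin n, (v = p ∨ v = q ∨ v = σ) → ((I.vars g 2 = v ∧ I.vars g 3 = u) ∨ (I.vars g 2 = u ∧ I.vars g 3 = v)) →
      u ≠ p → u ≠ q → u ≠ σ →
      (∃ D ⊆ K.erase e, ∃ t : Bool, IsJoin I w₁.1 D t ∧ (∀ j ∈ D, Through I u j) ∧ (t = true → ∀ g' ∈ w₁.2.1, Through I u g') ∧
          joinValue y w₁.2.2 D t = 1) ∨
      (u ∉ w₁.1 ∧ (∀ j ∈ K, I.vars j 0 ≠ u ∧ I.vars j 1 ≠ u) ∧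
        ∃ Z : Finset (Fin n), σ ∈ Z ∧ (∀ j ∈ K ∪ w₁.2.1, (I.vars j 2 = u → I.vars j 3 ∈ Z) ∧ (I.vars j 3 = u → I.vars j 2 ∈ Z)) ∧
          (∀ w ∈ Z, ∀ j ∈ K, I.vars j 0 ≠ w ∧ I.vars j 1 ≠ w) ∧ (∀ w ∈ Z, w ∉ w₁.1) ∧
          ∀ D ⊆ K, ∀ t : Bool, IsJoin I w₁.1 D t → (∀ j ∈ D, Dead I Z j) → (t = true → ∀ g' ∈ w₁.2.1, Dead I Z g') →
            joinValue y w₁.2.2 D t ≠ 1))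
    (hT3 : ¬ SatPair I y K w₁ w₂) (hM0 : SatPair I y (K.erase e) w₁ w₂) : False := by
  obtain ⟨x, hx, hx₂⟩ := exists_sliceBut_of_satPair_erase hM0
  exact gval_ne_on_sliceBut_shared H (T3_of_not_satPair hT3) hSG (exists_idle_shared_of_joins H hT hC₁ hpriv hidle)
    (partners_shared_of_joins H hT hC₁ hpriv hpart) hx hx₂

/-- **THE SHARED-LITERAL MEMBER KILL FOR MINIMAL CORES (`TerminalNC`), JOIN FORM.** -/
theorem not_terminalNC_of_shared_member_joins {r : ℕ} (H : Setup I K w₁ w₂ e o σ p q) (hT : Typed I)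
    (hSG : ∀ g ∈ w₂.2.1, ∀ g' ∈ w₂.2.1, g' ≠ g → ¬ ((I.vars g' 2 = I.vars g 2 ∧ I.vars g' 3 = I.vars g 3) ∨
      (I.vars g' 2 = I.vars g 3 ∧ I.vars g' 3 = I.vars g 2)))
    (hC₁ : ∀ v ∈ w₁.1, ∀ j ∈ K ∪ w₁.2.1, ¬ Through I v j)
    (hpriv : ∀ j ∈ K ∪ w₁.2.1, ∃ a, Through I a j ∧ ∀ j' ∈ K ∪ w₁.2.1, Through I a j' → j' = j)
    (hidle : ∀ D ⊆ K, ∀ t : Bool, IsJoin I w₁.1 D t → (∀ j ∈ D, Through I σ j) → (t = true → ∀ g ∈ w₁.2.1, Through I σ g) →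
      joinValue y w₁.2.2 D t ≠ 1)
    (hpart : ∀ g ∈ w₂.2.1, ∀ u v : Fin n, (v = p ∨ v = q ∨ v = σ) → ((I.vars g 2 = v ∧ I.vars g 3 = u) ∨ (I.vars g 2 = u ∧ I.vars g 3 = v)) →
      u ≠ p → u ≠ q → u ≠ σ →
      (∃ D ⊆ K.erase e, ∃ t : Bool, IsJoin I w₁.1 D t ∧ (∀ j ∈ D, Through I u j) ∧ (t = true → ∀ g' ∈ w₁.2.1, Through I u g') ∧
          joinValue y w₁.2.2 D t = 1) ∨
      (u ∉ w₁.1 ∧ (∀ j ∈ K, I.vars j 0 ≠ u ∧ I.vars j 1 ≠ u) ∧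
        ∃ Z : Finset (Fin n), σ ∈ Z ∧ (∀ j ∈ K ∪ w₁.2.1, (I.vars j 2 = u → I.vars j 3 ∈ Z) ∧ (I.vars j 3 = u → I.vars j 2 ∈ Z)) ∧
          (∀ w ∈ Z, ∀ j ∈ K, I.vars j 0 ≠ w ∧ I.vars j 1 ≠ w) ∧ (∀ w ∈ Z, w ∉ w₁.1) ∧
          ∀ D ⊆ K, ∀ t : Bool, IsJoin I w₁.1 D t → (∀ j ∈ D, Dead I Z j) → (t = true → ∀ g' ∈ w₁.2.1, Dead I Z g') →
            joinValue y w₁.2.2 D t ≠ 1)) :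
    ¬ TerminalNC I r y K w₁ w₂ := fun ht =>
  false_of_shared_member_joins H hT hSG hC₁ hpriv hidle hpart ht.2.2.2.2.2.1 (ht.2.2.2.2.2.2 e H.he)

/-- **The semantic shared-literal kill for minimal cores** (`PstarSharedMemberKill.not_terminal_of_shared_member` with `TerminalNC`). -/
theorem not_terminalNC_of_shared_member {r : ℕ} (H : Setup I K w₁ w₂ e o σ p q)
    (hSG : ∀ g ∈ w₂.2.1, ∀ g' ∈ w₂.2.1, g' ≠ g → ¬ ((I.vars g' 2 = I.vars g 2 ∧ I.vars g' 3 = I.vars g 3) ∨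
      (I.vars g' 2 = I.vars g 3 ∧ I.vars g' 3 = I.vars g 2)))
    (hA₁ : ∃ z, InSlice I y K w₁ z ∧ z σ = false)
    (hthaw : ∀ g ∈ w₂.2.1, ∀ u v : Fin n, (v = p ∨ v = q ∨ v = σ) → ((I.vars g 2 = v ∧ I.vars g 3 = u) ∨ (I.vars g 2 = u ∧ I.vars g 3 = v)) →
      u ≠ p → u ≠ q → u ≠ σ →
      (∀ x x' : Fin n → Bool, InSliceBut I y K e w₁ x → InSliceBut I y K e w₁ x' → x u = x' u) ∨
      (∃ z, (InSlice I y K w₁ z ∧ z σ = false) ∧ InSlice I y K w₁ (Function.update z u (!z u)))) :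
    ¬ TerminalNC I r y K w₁ w₂ := by
  intro ht
  obtain ⟨x, hx, hx₂⟩ := terminalNC_M0 ht H.he
  exact gval_ne_on_sliceBut_shared H (terminalNC_T3 ht) hSG hA₁ hthaw hx hx₂

end Shared

end Summit.PneNP.PneNP.Theorems.PstarMemberKillCores
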